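import Summits.CriticalPhenomena.PercolationContinuityZ3.Theorems.TransplantMonotonicTreeHarris
import Summits.CriticalPhenomena.PercolationContinuityZ3.Theorems.PercNearOneGluingNoHeavyLowerTailFKAnalogues
import Literature.Probability.LatticeModels.RandomClusterEdgeWeightsConditioning
import HarnessLib

/-!
# FK sub-lane: the decision-tree Harris inequality for the random-cluster measure `φ^B_{w,q}`, every `q ≥ 1` (row J instance)

Support file (`--supports stmt-CriticalPhenomena-4575`), FK sub-lane `prim-bschramm-fk-2` (gen 2); builds on p205010 (kernel theorem,
internal audit signed; external expert review pending).  No named facts, no sorries, no definitions; standard axioms.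

`TransplantMonotonicTreeHarris.lean` (p207809) proves the decision-tree Harris inequality ABSTRACTLY: for a nonnegative weight `μ` on a finite
configuration type, two events `A, B` and a query-stable family of contexts on which "`e` open" is positively correlated with `A` and with `B`
(the monotonicity of Duminil-Copin–Raoufi–Tassion / Grimmett Thm (2.24)), `μ(A) μ(B) ≤ μ(Ω)·Σ_ω μ(ω) μ(A | cyl_t ω) μ(B | cyl_t ω)` for EVERY
decision tree `t`.  THIS FILE discharges the hypotheses for `μ = rcWeightW w q B` (the weights of `φ^B_{𝐩,q} = rcMeasureW w q B`), `q ≥ 1`,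
with the contexts = cylinders `{ω | ω ∩ R = ρ}` (revealed pairs `R`, revealed open pairs `ρ ⊆ R`) and `∅`:
* query-stability is set algebra (`cyl_inter_open_eq`, `cyl_inter_closed_eq`, …);
* the monotonicity hypothesis is Grimmett's Thm (3.7) in fk-1's weight-surgery form (`rcMeasureW_real_inter_cylinder`: conditionally on a
  cylinder, `φ` is again an edge-parameter random-cluster measure, with the revealed pairs pinned to weight `1`/`0`) followed by the
  comparison in `𝐩` (`rcMeasureW_real_mono_weights`, Grimmett Thm (3.21)): pinning `e` open instead of closed raises every increasing event.
RESULT `FK.treeHarris_rc`: for `q ≥ 1`, increasing `A, B ⊆ {0,1}^{Sym2 V}` and every decision tree `t` over the pairs,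
  `φ(A)·φ(B) ≤ Σ_ω φ{ω} · φ(A | cyl_t ω) · φ(B | cyl_t ω)`,   `φ = rcMeasureW w q B`
— Gladkov's Theorem 3.2 (product measures) for the random-cluster measure; FK-PLAN row J / FK-Q2 §3.1 as a tree theorem for `φ_{𝐩,q}` itself
(the abstract form needs no FKG lattice ⇒ monotonic argument here because Thm (3.7) makes every cylinder-conditional measure an FK measure).
Not in print for `q > 1` (FK-Q2 §3.1 presearch).
[cite: Gladkov2024, Thm. 3.2 (p. 4)] [cite: Grimmett2006, Thm. (3.7) (p. 39), Thm. (3.21), Thm. (3.8)(b)]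
-/

noncomputable section

namespace Summit.CriticalPhenomena.PercolationContinuityZ3.Theorems.FK

open MeasureTheory Set Finset
open Literature.Probability.LatticeModels Literature.Probability.Percolation
open Summit.CriticalPhenomena.PercolationContinuityZ3.Theorems.MonotonicTree
open scoped Classical

variable {V : Type*} [Fintype V]

/-! ## Cylinders of revealed pairs -/

omit [Fintype V] in
/-- A cylinder with `e` revealed open, cut by "`e` open", is itself. [folklore] -/
theorem cyl_inter_open_of_mem {R ρ : Set (Sym2 V)} {e : Sym2 V} (heρ : e ∈ ρ) :
    ({ω : BondConfig V | ω ∩ R = ρ} ∩ {ω | e ∈ ω}) = {ω : BondConfig V | ω ∩ R = ρ} := by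
  ext ω
  simp only [mem_inter_iff, mem_setOf_eq, and_iff_left_iff_imp]
  intro h
  have : e ∈ ω ∩ R := by rw [h]; exact heρ
  exact this.1

omit [Fintype V] in
/-- A cylinder with `e` revealed closed, cut by "`e` open", is empty. [folklore] -/
theorem cyl_inter_open_of_not_mem {R ρ : Set (Sym2 V)} {e : Sym2 V} (heR : e ∈ R) (heρ : e ∉ ρ) :
    ({ω : BondConfig V | ω ∩ R = ρ} ∩ {ω | e ∈ ω}) = ∅ := by
  ext ω
  simp only [mem_inter_iff, mem_setOf_eq, mem_empty_iff_false, iff_false, not_and]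
  intro h he
  exact heρ (h ▸ ⟨he, heR⟩)

omit [Fintype V] in
/-- A cylinder with `e` revealed open, cut by "`e` closed", is empty. [folklore] -/
theorem cyl_inter_closed_of_mem {R ρ : Set (Sym2 V)} {e : Sym2 V} (heρ : e ∈ ρ) :
    ({ω : BondConfig V | ω ∩ R = ρ} ∩ {ω | e ∈ ω}ᶜ) = ∅ := by
  ext ω
  simp only [mem_inter_iff, mem_setOf_eq, mem_compl_iff, mem_empty_iff_false, iff_false, not_and, not_not]
  intro h
  have : e ∈ ω ∩ R := by rw [h]; exact heρ
  exact this.1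

omit [Fintype V] in
/-- A cylinder with `e` revealed closed, cut by "`e` closed", is itself. [folklore] -/
theorem cyl_inter_closed_of_not_mem {R ρ : Set (Sym2 V)} {e : Sym2 V} (heR : e ∈ R) (heρ : e ∉ ρ) :
    ({ω : BondConfig V | ω ∩ R = ρ} ∩ {ω | e ∈ ω}ᶜ) = {ω : BondConfig V | ω ∩ R = ρ} := by
  ext ω
  simp only [mem_inter_iff, mem_setOf_eq, mem_compl_iff, and_iff_left_iff_imp]
  intro h he
  exact heρ (h ▸ ⟨he, heR⟩)

omit [Fintype V] in
/-- Revealing a fresh pair open refines the cylinder. [folklore] -/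
theorem cyl_inter_open_eq {R ρ : Set (Sym2 V)} {e : Sym2 V} (heR : e ∉ R) (hρ : ρ ⊆ R) :
    ({ω : BondConfig V | ω ∩ R = ρ} ∩ {ω | e ∈ ω}) = {ω : BondConfig V | ω ∩ insert e R = insert e ρ} := by
  ext ω
  simp only [mem_inter_iff, mem_setOf_eq]
  constructor
  · rintro ⟨h, he⟩
    rw [Set.inter_insert_of_mem he, h]
  · intro h
    have he : e ∈ ω := by
      have : e ∈ ω ∩ insert e R := by rw [h]; exact mem_insert e ρ
      exact this.1
    refine ⟨?_, he⟩
    ext f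
    constructor
    · rintro ⟨hfω, hfR⟩
      have : f ∈ ω ∩ insert e R := ⟨hfω, mem_insert_of_mem e hfR⟩
      rw [h] at this
      rcases this with rfl | hf
      · exact absurd hfR heR
      · exact hf
    · intro hf
      have : f ∈ insert e ρ := mem_insert_of_mem e hf
      rw [← h] at this
      exact ⟨this.1, hρ hf⟩

omit [Fintype V] in
/-- Revealing a fresh pair closed refines the cylinder. [folklore] -/
theorem cyl_inter_closed_eq {R ρ : Set (Sym2 V)} {e : Sym2 V} (heR : e ∉ R) (hρ : ρ ⊆ R) :
    ({ω : BondConfig V | ω ∩ R = ρ} ∩ {ω | e ∈ ω}ᶜ) = {ω : BondConfig V | ω ∩ insert e R = ρ} := by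
  ext ω
  simp only [mem_inter_iff, mem_setOf_eq, mem_compl_iff]
  constructor
  · rintro ⟨h, he⟩
    rw [Set.inter_insert_of_notMem he, h]
  · intro h
    have he : e ∉ ω := by
      intro he
      have : e ∈ ω ∩ insert e R := ⟨he, mem_insert e R⟩
      rw [h] at this
      exact heR (hρ this)
    refine ⟨?_, he⟩
    rw [← h, Set.inter_insert_of_notMem he]

omit [Fintype V] in
/-- A cylinder in the "`ω ∖ F = ξ`" form of `rcMeasureW_real_inter_cylinder`. [folklore] -/
theorem cyl_eq_sdiff_compl (R ρ : Set (Sym2 V)) :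
    {ω : BondConfig V | ω ∩ R = ρ} = {ω : BondConfig V | ω \ Rᶜ = ρ} := by
  ext ω; simp only [mem_setOf_eq, Set.sdiff_compl]

/-! ## Masses of the random-cluster weights -/

/-- `mass (rcWeightW w q B) S = Z · φ(S)`. [cite: Grimmett2006, §1.4 eq. (1.20) (p. 15)] -/
theorem mass_rcWeightW_eq (w : Sym2 V → unitInterval) {q : ℝ} (hq : 0 < q) (B : Set V) (S : Set (BondConfig V)) :
    mass (rcWeightW w q B) S = rcPartitionFunctionW w q B * (rcMeasureW w q B).real S := by
  have hZ := rcPartitionFunctionW_pos w hq B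
  rw [rcMeasureW_real_apply w hq B S, mass, Finset.mul_sum]
  refine Finset.sum_congr rfl fun ω _ => ?_
  split_ifs
  · field_simp
  · simp

omit [Fintype V] in
/-- The pinned weights are monotone in the set of pairs pinned open. [cite: Grimmett2006, Thm. (3.7) (p. 39)] -/
theorem condWeights_mono (w : Sym2 V → unitInterval) (F : Set (Sym2 V)) {ξ ξ' : Set (Sym2 V)} (h : ξ ⊆ ξ') (e : Sym2 V) :
    condWeights w F ξ e ≤ condWeights w F ξ' e := by
  unfold condWeights
  by_cases hF : e ∈ F
  · simp [hF]
  · by_cases hξ : e ∈ ξ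
    · simp [hF, hξ, h hξ]
    · simp only [hF, hξ, if_false]
      split_ifs
      · exact unitInterval.nonneg _
      · exact le_rfl

/-- **The monotonicity hypothesis of the abstract tree-Harris inequality, for `φ^B_{𝐩,q}`, `q ≥ 1`**: on a cylinder of revealed pairs
`R ⊇ ρ` and a fresh pair `e ∉ R`, "`e` open" is positively correlated with every increasing event:
`mass(A ∩ C ∩ {e closed})·mass(C ∩ {e open}) ≤ mass(A ∩ C ∩ {e open})·mass(C ∩ {e closed})` (Grimmett Thm (3.7) + Thm (3.21)).
[cite: Grimmett2006, Thm. (3.7) (p. 39), Thm. (3.21)] -/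
theorem rcWeightW_cyl_cond_mono (w : Sym2 V → unitInterval) {q : ℝ} (hq : 1 ≤ q) (B : Set V) {A : Set (BondConfig V)}
    (hA : IsUpperSet A) {R ρ : Set (Sym2 V)} (hρ : ρ ⊆ R) {e : Sym2 V} (heR : e ∉ R) :
    mass (rcWeightW w q B) (A ∩ ({ω : BondConfig V | ω ∩ R = ρ} ∩ {ω | e ∈ ω}ᶜ)) *
        mass (rcWeightW w q B) ({ω : BondConfig V | ω ∩ R = ρ} ∩ {ω | e ∈ ω}) ≤
      mass (rcWeightW w q B) (A ∩ ({ω : BondConfig V | ω ∩ R = ρ} ∩ {ω | e ∈ ω})) *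
        mass (rcWeightW w q B) ({ω : BondConfig V | ω ∩ R = ρ} ∩ {ω | e ∈ ω}ᶜ) := by
  have hq0 : 0 < q := one_pos.trans_le hq
  have hZ := rcPartitionFunctionW_pos w hq0 B
  have hd1 : Disjoint (insert e ρ) (insert e R)ᶜ := by
    rw [Set.disjoint_compl_right_iff_subset]; exact Set.insert_subset_insert hρ
  have hd0 : Disjoint ρ (insert e R)ᶜ := by
    rw [Set.disjoint_compl_right_iff_subset]; exact hρ.trans (Set.subset_insert e R)
  rw [cyl_inter_open_eq heR hρ, cyl_inter_closed_eq heR hρ, cyl_eq_sdiff_compl (insert e R) (insert e ρ),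
    cyl_eq_sdiff_compl (insert e R) ρ]
  simp only [mass_rcWeightW_eq w hq0 B]
  rw [rcMeasureW_real_inter_cylinder w hq0 B hd0 A, rcMeasureW_real_inter_cylinder w hq0 B hd1 A]
  have hmono : (rcMeasureW (condWeights w (insert e R)ᶜ ρ) q B).real A ≤
      (rcMeasureW (condWeights w (insert e R)ᶜ (insert e ρ)) q B).real A :=
    rcMeasureW_real_mono_weights (fun f => condWeights_mono w (insert e R)ᶜ (Set.subset_insert e ρ) f) hq B hA
  have h0 : 0 ≤ (rcMeasureW w q B).real {ω : BondConfig V | ω \ (insert e R)ᶜ = ρ} := measureReal_nonneg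
  have h1 : 0 ≤ (rcMeasureW w q B).real {ω : BondConfig V | ω \ (insert e R)ᶜ = insert e ρ} := measureReal_nonneg
  have key := mul_le_mul_of_nonneg_left (mul_le_mul_of_nonneg_left hmono (mul_nonneg h0 h1)) (mul_nonneg hZ.le hZ.le)
  have e1 : rcPartitionFunctionW w q B * ((rcMeasureW w q B).real {ω : BondConfig V | ω \ (insert e R)ᶜ = ρ} *
        (rcMeasureW (condWeights w (insert e R)ᶜ ρ) q B).real A) *
      (rcPartitionFunctionW w q B * (rcMeasureW w q B).real {ω : BondConfig V | ω \ (insert e R)ᶜ = insert e ρ}) =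
      rcPartitionFunctionW w q B * rcPartitionFunctionW w q B *
        ((rcMeasureW w q B).real {ω : BondConfig V | ω \ (insert e R)ᶜ = ρ} *
          (rcMeasureW w q B).real {ω : BondConfig V | ω \ (insert e R)ᶜ = insert e ρ} *
          (rcMeasureW (condWeights w (insert e R)ᶜ ρ) q B).real A) := by ring
  have e2 : rcPartitionFunctionW w q B * ((rcMeasureW w q B).real {ω : BondConfig V | ω \ (insert e R)ᶜ = insert e ρ} *
        (rcMeasureW (condWeights w (insert e R)ᶜ (insert e ρ)) q B).real A) *
      (rcPartitionFunctionW w q B * (rcMeasureW w q B).real {ω : BondConfig V | ω \ (insert e R)ᶜ = ρ}) =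
      rcPartitionFunctionW w q B * rcPartitionFunctionW w q B *
        ((rcMeasureW w q B).real {ω : BondConfig V | ω \ (insert e R)ᶜ = ρ} *
          (rcMeasureW w q B).real {ω : BondConfig V | ω \ (insert e R)ᶜ = insert e ρ} *
          (rcMeasureW (condWeights w (insert e R)ᶜ (insert e ρ)) q B).real A) := by ring
  rw [e1, e2]
  exact key

/-- **Decision-tree Harris inequality for the random-cluster measure, `q ≥ 1`.**  For increasing events `A`, `B` and EVERY decision tree `t`
over the pairs (adaptive revealment, any stopping rule), the conditional probabilities revealed by the tree are positively correlated:
`φ(A)·φ(B) ≤ Σ_ω φ{ω}·φ(A | cyl_t ω)·φ(B | cyl_t ω)` with `φ = rcMeasureW w q B` (real division, `x/0 = 0`).  Gladkov's Theorem 3.2 for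
`φ_{𝐩,q}`; the abstract node-by-node argument is `MonotonicTree.DTr.mass_mul_mass_le_sum_condProd` (p207809), the monotonicity input is
`rcWeightW_cyl_cond_mono`. [cite: Gladkov2024, Thm. 3.2 (p. 4)] [cite: Grimmett2006, Thm. (3.7) (p. 39), Thm. (3.8)(b)] -/
theorem treeHarris_rc (w : Sym2 V → unitInterval) {q : ℝ} (hq : 1 ≤ q) (B : Set V) {A A' : Set (BondConfig V)}
    (hA : IsUpperSet A) (hA' : IsUpperSet A') (t : DTr (Sym2 V)) :
    (rcMeasureW w q B).real A * (rcMeasureW w q B).real A' ≤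
      ∑ ω : BondConfig V, (rcMeasureW w q B).real {ω} *
        ((rcMeasureW w q B).real (A ∩ t.cyl (fun e => {ω : BondConfig V | e ∈ ω}) ω) /
          (rcMeasureW w q B).real (t.cyl (fun e => {ω : BondConfig V | e ∈ ω}) ω)) *
        ((rcMeasureW w q B).real (A' ∩ t.cyl (fun e => {ω : BondConfig V | e ∈ ω}) ω) /
          (rcMeasureW w q B).real (t.cyl (fun e => {ω : BondConfig V | e ∈ ω}) ω)) := by
  have hq0 : 0 < q := one_pos.trans_le hq
  have hZ := rcPartitionFunctionW_pos w hq0 B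
  haveI := isProbabilityMeasure_rcMeasureW w hq0 B
  have hμ0 : ∀ ω, 0 ≤ rcWeightW w q B ω := fun ω => rcWeightW_nonneg w hq0.le B ω
  have hmass0 : mass (rcWeightW w q B) (∅ : Set (BondConfig V)) = 0 := by simp [mass]
  -- contexts: the empty set and the cylinders of revealed pairs
  have hPuniv : (Set.univ : Set (BondConfig V)) = ∅ ∨
      ∃ R ρ : Set (Sym2 V), ρ ⊆ R ∧ (Set.univ : Set (BondConfig V)) = {ω | ω ∩ R = ρ} :=
    Or.inr ⟨∅, ∅, le_rfl, by ext ω; simp⟩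
  have hPstab : ∀ (C : Set (BondConfig V)) (e : Sym2 V), (C = ∅ ∨ ∃ R ρ : Set (Sym2 V), ρ ⊆ R ∧ C = {ω | ω ∩ R = ρ}) →
      ((C ∩ {ω | e ∈ ω}) = ∅ ∨ ∃ R ρ : Set (Sym2 V), ρ ⊆ R ∧ (C ∩ {ω | e ∈ ω}) = {ω | ω ∩ R = ρ}) ∧
      ((C ∩ {ω | e ∈ ω}ᶜ) = ∅ ∨ ∃ R ρ : Set (Sym2 V), ρ ⊆ R ∧ (C ∩ {ω | e ∈ ω}ᶜ) = {ω | ω ∩ R = ρ}) := by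
    rintro C e (rfl | ⟨R, ρ, hρ, rfl⟩)
    · exact ⟨Or.inl (Set.empty_inter _), Or.inl (Set.empty_inter _)⟩
    · by_cases heR : e ∈ R
      · by_cases heρ : e ∈ ρ
        · exact ⟨Or.inr ⟨R, ρ, hρ, cyl_inter_open_of_mem heρ⟩, Or.inl (cyl_inter_closed_of_mem heρ)⟩
        · exact ⟨Or.inl (cyl_inter_open_of_not_mem heR heρ), Or.inr ⟨R, ρ, hρ, cyl_inter_closed_of_not_mem heR heρ⟩⟩
      · exact ⟨Or.inr ⟨insert e R, insert e ρ, Set.insert_subset_insert hρ, cyl_inter_open_eq heR hρ⟩,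
          Or.inr ⟨insert e R, ρ, hρ.trans (Set.subset_insert e R), cyl_inter_closed_eq heR hρ⟩⟩
  -- the monotonicity hypothesis for an increasing event
  have hmono : ∀ {E : Set (BondConfig V)}, IsUpperSet E → ∀ (C : Set (BondConfig V)) (e : Sym2 V),
      (C = ∅ ∨ ∃ R ρ : Set (Sym2 V), ρ ⊆ R ∧ C = {ω | ω ∩ R = ρ}) →
      mass (rcWeightW w q B) (E ∩ (C ∩ {ω | e ∈ ω}ᶜ)) * mass (rcWeightW w q B) (C ∩ {ω | e ∈ ω}) ≤
        mass (rcWeightW w q B) (E ∩ (C ∩ {ω | e ∈ ω})) * mass (rcWeightW w q B) (C ∩ {ω | e ∈ ω}ᶜ) := by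
    intro E hE C e hC
    rcases hC with rfl | ⟨R, ρ, hρ, rfl⟩
    · simp only [Set.empty_inter, Set.inter_empty, hmass0, mul_zero, le_refl]
    · by_cases heR : e ∈ R
      · by_cases heρ : e ∈ ρ
        · simp only [cyl_inter_closed_of_mem heρ, Set.inter_empty, hmass0, zero_mul, mul_zero, le_refl]
        · simp only [cyl_inter_open_of_not_mem heR heρ, Set.inter_empty, hmass0, mul_zero, zero_mul, le_refl]
      · exact rcWeightW_cyl_cond_mono w hq B hE hρ heR
  have key := DTr.mass_mul_mass_le_sum_condProd (rcWeightW w q B) (fun e : Sym2 V => {ω : BondConfig V | e ∈ ω})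
    (fun C : Set (BondConfig V) => C = ∅ ∨ ∃ R ρ : Set (Sym2 V), ρ ⊆ R ∧ C = {ω | ω ∩ R = ρ}) A A' hμ0 hPuniv hPstab
    (fun C e hC => hmono hA C e hC) (fun C e hC => hmono hA' C e hC) t
  -- translate masses into `φ`
  have hratio : ∀ S T : Set (BondConfig V), mass (rcWeightW w q B) (S ∩ T) / mass (rcWeightW w q B) T =
      (rcMeasureW w q B).real (S ∩ T) / (rcMeasureW w q B).real T := by
    intro S T
    rw [mass_rcWeightW_eq w hq0 B, mass_rcWeightW_eq w hq0 B, mul_div_mul_left _ _ hZ.ne']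
  have hsing : ∀ ω : BondConfig V, rcWeightW w q B ω = rcPartitionFunctionW w q B * (rcMeasureW w q B).real {ω} := by
    intro ω
    rw [rcMeasureW_real_singleton w hq0 B ω]
    field_simp
  simp only [hratio] at key
  rw [mass_rcWeightW_eq w hq0 B, mass_rcWeightW_eq w hq0 B, mass_rcWeightW_eq w hq0 B, probReal_univ, mul_one] at key
  have hsum : ∑ ω, rcWeightW w q B ω *
        ((rcMeasureW w q B).real (A ∩ t.cyl (fun e => {ω : BondConfig V | e ∈ ω}) ω) /
          (rcMeasureW w q B).real (t.cyl (fun e => {ω : BondConfig V | e ∈ ω}) ω)) *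
        ((rcMeasureW w q B).real (A' ∩ t.cyl (fun e => {ω : BondConfig V | e ∈ ω}) ω) /
          (rcMeasureW w q B).real (t.cyl (fun e => {ω : BondConfig V | e ∈ ω}) ω)) =
      rcPartitionFunctionW w q B * ∑ ω, (rcMeasureW w q B).real {ω} *
        ((rcMeasureW w q B).real (A ∩ t.cyl (fun e => {ω : BondConfig V | e ∈ ω}) ω) /
          (rcMeasureW w q B).real (t.cyl (fun e => {ω : BondConfig V | e ∈ ω}) ω)) *
        ((rcMeasureW w q B).real (A' ∩ t.cyl (fun e => {ω : BondConfig V | e ∈ ω}) ω) /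
          (rcMeasureW w q B).real (t.cyl (fun e => {ω : BondConfig V | e ∈ ω}) ω)) := by
    rw [Finset.mul_sum]
    refine Finset.sum_congr rfl fun ω _ => ?_
    rw [hsing ω]; ring
  rw [hsum] at key
  set S := ∑ ω, (rcMeasureW w q B).real {ω} *
        ((rcMeasureW w q B).real (A ∩ t.cyl (fun e => {ω : BondConfig V | e ∈ ω}) ω) /
          (rcMeasureW w q B).real (t.cyl (fun e => {ω : BondConfig V | e ∈ ω}) ω)) *
        ((rcMeasureW w q B).real (A' ∩ t.cyl (fun e => {ω : BondConfig V | e ∈ ω}) ω) /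
          (rcMeasureW w q B).real (t.cyl (fun e => {ω : BondConfig V | e ∈ ω}) ω))
  have lhs_eq : rcPartitionFunctionW w q B * (rcMeasureW w q B).real A * (rcPartitionFunctionW w q B * (rcMeasureW w q B).real A') =
      rcPartitionFunctionW w q B * rcPartitionFunctionW w q B * ((rcMeasureW w q B).real A * (rcMeasureW w q B).real A') := by ring
  have rhs_eq : rcPartitionFunctionW w q B * (rcPartitionFunctionW w q B * S) =
      rcPartitionFunctionW w q B * rcPartitionFunctionW w q B * S := by ring
  rw [lhs_eq, rhs_eq] at key
  exact le_of_mul_le_mul_left key (mul_pos hZ hZ)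

end Summit.CriticalPhenomena.PercolationContinuityZ3.Theorems.FK

end
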